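import Summits.RiemannHypothesis.RiemannHypothesis.Theorems.ThetaTier2RowSound
import HarnessLib

/-!
# THETA tier-2 — DATA FACTS of a row for the bridge `T2Matches` (cc-s2-1; RH-FREE bookkeeping)

Helper lemmas about `Row2.inp` / `Row2.real` (ThetaTier2Row/RowSound) that the E-side bridge (`WeilColumnThetaUCT2Valid.T2Matches`,
weil-1's `ThetaTier2Bridge`) needs and that are pure bookkeeping of THIS seat's definitions: the integer fields of `r.inp` (`m, K = 6, Jt = 300,
Kw = 400, ncut, j0, j1p, |gainPairs| = 64`), `Jt·τ = D = 3`, `Kw·τ = W_l = 4`, the side conditions `η′ ≤ Jt·τ`, `1/(m+1) ≤ Kw·τ`, the layer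
window `j0·τ ≤ η′ − 2δ` and `η′ ≤ j1p·τ` (when `j0 < j1p`), `0 < t₀ ≤ 1`, `ζ⁺(m+1) ≤ val zm1H`, `τ ≤ val tau`, and the tail exponentials of
`Row2.real` rewritten with `Jt·τ`, `Kw·τ`.  Nothing here bears on the truth of RH.
-/

set_option linter.dupNamespace false  -- the mandated namespace repeats `RiemannHypothesis`
set_option autoImplicit false

namespace Summit.RiemannHypothesis.RiemannHypothesis.Theorems.ThetaTier2

open ThetaTier1 (zetaHi)
open Real

namespace Row2

variable (r : Row2)

/-! ## Integer fields of `r.inp` -/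

/-- `r.inp.m = r.m`. [this cell] -/
theorem inp_m : r.inp.m = r.m := rfl
/-- `r.inp.K = 6`. [this cell] -/
theorem inp_K : r.inp.K = KH := rfl
/-- `r.inp.Jt = 300`. [this cell] -/
theorem inp_Jt : r.inp.Jt = JT := rfl
/-- `r.inp.Kw = 400`. [this cell] -/
theorem inp_Kw : r.inp.Kw = KW := rfl
/-- `r.inp.ncut = ⌈η′/τ⌉`. [this cell] -/
theorem inp_ncut : r.inp.ncut = r.ncut := rfl
/-- `r.inp.j0 = r.j0`. [this cell] -/
theorem inp_j0 : r.inp.j0 = r.j0 := rfl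
/-- `r.inp.j1p = r.j1p`. [this cell] -/
theorem inp_j1p : r.inp.j1p = r.j1p := rfl
/-- `r.inp.tau = ⌈τ·2⁹⁶⌉`. [this cell] -/
theorem inp_tau : r.inp.tau = upQ TAU := rfl
/-- `r.inp.zm1H = ⌈ζ⁺(m+1)·2⁹⁶⌉`. [this cell] -/
theorem inp_zm1H : r.inp.zm1H = upQ (zetaHi (r.m + 1)) := rfl
/-- `r.inp.gainPairs` is the list of the 64 rounded gain pairs. [this cell] -/
theorem inp_gainPairs : r.inp.gainPairs = (List.range JG).map fun j => (dnQ (r.gainA j), dnQ (r.gainB j)) := rfl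
/-- `|r.inp.gainPairs| = 64`. [this cell] -/
theorem inp_gainPairs_length : r.inp.gainPairs.length = JG := by
  rw [inp_gainPairs, List.length_map, List.length_range]
/-- `0 < |r.inp.gainPairs|`. [this cell] -/
theorem inp_gainPairs_length_pos : 0 < r.inp.gainPairs.length := by
  rw [inp_gainPairs_length]; unfold JG; norm_num

/-! ## The campaign constants as reals -/

/-- `Jt·τ = 3`. [this cell] -/
theorem JT_mul_TAU : (JT : ℝ) * ((TAU : ℚ) : ℝ) = 3 := by unfold JT TAU; push_cast; norm_num
/-- `Kw·τ = 4`. [this cell] -/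
theorem KW_mul_TAU : (KW : ℝ) * ((TAU : ℚ) : ℝ) = 4 := by unfold KW TAU; push_cast; norm_num
/-- `D = 3` as a cast. [this cell] -/
theorem DEPTH_cast : ((DEPTH : ℚ) : ℝ) = 3 := by unfold DEPTH; push_cast; norm_num
/-- `W_l = 4` as a cast. [this cell] -/
theorem WL_cast : ((WL : ℚ) : ℝ) = 4 := by unfold WL; push_cast; norm_num
/-- `r.real.τ = τ`. [this cell] -/
theorem real_τ : r.real.τ = ((TAU : ℚ) : ℝ) := rfl
/-- `0 < τ`. [this cell] -/
theorem real_τ_pos : 0 < r.real.τ := by rw [real_τ]; unfold TAU; push_cast; norm_num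
/-- `τ ≤ val r.inp.tau`. [this cell] -/
theorem τ_le_val_tau : r.real.τ ≤ val r.inp.tau := by rw [real_τ, inp_tau]; exact le_val_upQ _
/-- `ζ⁺(m+1) ≤ val r.inp.zm1H`. [this cell] -/
theorem zetaHi_le_val_zm1H : ((zetaHi (r.m + 1) : ℚ) : ℝ) ≤ val r.inp.zm1H := by rw [inp_zm1H]; exact le_val_upQ _

/-! ## Side conditions -/

/-- `η′ ≤ 1/20`. [this cell] -/
theorem eta_le : r.eta ≤ 1 / 20 := by unfold eta; split_ifs <;> norm_num
/-- `0 < η′`. [this cell] -/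
theorem eta_pos : 0 < r.eta := by unfold eta; split_ifs <;> norm_num
/-- `η′ ≤ Jt·τ` (`= 3`). [this cell] -/
theorem eta_le_D : (r.eta : ℝ) ≤ (r.inp.Jt : ℝ) * r.real.τ := by
  rw [inp_Jt, real_τ, JT_mul_TAU]
  have h : ((r.eta : ℚ) : ℝ) ≤ ((1 / 20 : ℚ) : ℝ) := by exact_mod_cast r.eta_le
  push_cast at h; linarith
/-- `1/(m+1) ≤ Kw·τ` (`= 4`). [this cell] -/
theorem Wl_ge : 1 / ((r.m : ℝ) + 1) ≤ (r.inp.Kw : ℝ) * r.real.τ := by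
  rw [inp_Kw, real_τ, KW_mul_TAU]
  have : (1 : ℝ) ≤ (r.m : ℝ) + 1 := by linarith [(Nat.cast_nonneg r.m : (0 : ℝ) ≤ r.m)]
  calc 1 / ((r.m : ℝ) + 1) ≤ 1 := by rw [div_le_one (by linarith)]; exact this
    _ ≤ 4 := by norm_num
/-- `0 < t₀`. [this cell] -/
theorem real_t0_pos : 0 < r.real.t0 := by show (0 : ℝ) < ((r.t0 : ℚ) : ℝ); unfold t0; push_cast; positivity
/-- `t₀ ≤ 1`. [this cell] -/
theorem real_t0_le_one : r.real.t0 ≤ 1 := by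
  show ((r.t0 : ℚ) : ℝ) ≤ 1
  have h : r.t0 ≤ 1 := by
    unfold t0; rw [div_le_one (by positivity)]; exact one_le_pow₀ (by norm_num)
  exact_mod_cast h
/-- `e^{t₀/2} = r.real.e0`. [this cell] -/
theorem real_e0_eq : r.real.e0 = Real.exp (r.real.t0 / 2) := by
  show Real.exp (((r.t0 / 2 : ℚ)) : ℝ) = Real.exp (((r.t0 : ℚ) : ℝ) / 2); push_cast; ring_nf
/-- `r.real.d = δ / |gainPairs|`. [this cell] -/
theorem real_d_eq : r.real.d = (r.delta : ℝ) / r.inp.gainPairs.length := by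
  rw [inp_gainPairs_length]; show ((r.delta / JG : ℚ) : ℝ) = (r.delta : ℝ) / (JG : ℕ); push_cast; rfl
/-- `r.real.L = log q`. [this cell] -/
theorem real_L_eq : r.real.L = Real.log r.q := rfl

/-! ## The layer window -/

/-- When the window is nonempty, `2δ ≤ η′`. [this cell] -/
theorem two_delta_le_eta_of_lt (h : r.j0 < r.j1p) : 2 * r.delta ≤ r.eta := by
  by_contra hne
  have : r.j1p = 0 := by unfold j1p; rw [if_neg hne]
  omega
/-- `j0·τ ≤ η′ − 2δ` (nonempty window). [this cell] -/
theorem j0_mul_tau_le (h : r.j0 < r.j1p) : (r.inp.j0 : ℝ) * r.real.τ ≤ (r.eta : ℝ) - 2 * (r.delta : ℝ) := by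
  have h2 := r.two_delta_le_eta_of_lt h
  rw [inp_j0, real_τ]
  have hq : (r.j0 : ℚ) * TAU ≤ r.eta - 2 * r.delta := by
    unfold j0; rw [if_pos h2]
    have hτ : (0 : ℚ) < TAU := by unfold TAU; norm_num
    have hnn : 0 ≤ (r.eta - 2 * r.delta) / TAU := div_nonneg (by linarith) hτ.le
    have := Nat.floor_le hnn
    calc (⌊(r.eta - 2 * r.delta) / TAU⌋₊ : ℚ) * TAU ≤ (r.eta - 2 * r.delta) / TAU * TAU := mul_le_mul_of_nonneg_right this hτ.le
      _ = r.eta - 2 * r.delta := div_mul_cancel₀ _ hτ.ne'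
  have h' : (((r.j0 : ℚ) * TAU : ℚ) : ℝ) ≤ ((r.eta - 2 * r.delta : ℚ) : ℝ) := by exact_mod_cast hq
  push_cast at h'; exact h'
/-- `η′ ≤ j1p·τ` (nonempty window). [this cell] -/
theorem eta_le_j1p_mul_tau (h : r.j0 < r.j1p) : (r.eta : ℝ) ≤ (r.inp.j1p : ℝ) * r.real.τ := by
  have h2 := r.two_delta_le_eta_of_lt h
  rw [inp_j1p, real_τ]
  have hq : r.eta ≤ (r.j1p : ℚ) * TAU := by
    unfold j1p; rw [if_pos h2]
    have hτ : (0 : ℚ) < TAU := by unfold TAU; norm_num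
    rcases le_total (JT - 1) ⌊r.eta / TAU⌋₊ with hmin | hmin
    · rw [min_eq_left hmin]
      have hJ : ((JT - 1 + 1 : ℕ) : ℚ) * TAU = 3 := by unfold JT TAU; norm_num
      rw [hJ]; linarith [r.eta_le]
    · rw [min_eq_right hmin]
      have := Nat.lt_floor_add_one (r.eta / TAU)
      have h3 : r.eta < ((⌊r.eta / TAU⌋₊ + 1 : ℕ) : ℚ) * TAU := by
        rw [div_lt_iff₀ hτ] at this; push_cast at this ⊢; linarith
      exact h3.le
  have h' : ((r.eta : ℚ) : ℝ) ≤ (((r.j1p : ℚ) * TAU : ℚ) : ℝ) := by exact_mod_cast hq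
  push_cast at h'; exact h'
/-- `ncut·τ ≥ η′`: the cells `j ≥ ncut` lie beyond the cut layer. [this cell] -/
theorem eta_le_ncut_mul_tau : (r.eta : ℝ) ≤ (r.inp.ncut : ℝ) * r.real.τ := by
  rw [inp_ncut, real_τ]
  have hq : r.eta ≤ (r.ncut : ℚ) * TAU := by
    unfold ncut
    have hτ : (0 : ℚ) < TAU := by unfold TAU; norm_num
    have := Nat.le_ceil (r.eta / TAU)
    rw [div_le_iff₀ hτ] at this; exact this
  have h' : ((r.eta : ℚ) : ℝ) ≤ (((r.ncut : ℚ) * TAU : ℚ) : ℝ) := by exact_mod_cast hq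
  push_cast at h'; exact h'

/-! ## The tail exponentials of `Row2.real` with `Jt·τ`, `Kw·τ` -/

/-- `E1 = e^{−(2m+1)·Jtτ}`. [this cell] -/
theorem real_E1_eq : r.real.E1 = Real.exp (-(2 * r.m + 1 : ℝ) * ((r.inp.Jt : ℝ) * r.real.τ)) := by
  rw [inp_Jt, real_τ, JT_mul_TAU]; show Real.exp _ = _; congr 1; push_cast; rw [DEPTH_cast]
/-- `E2 = e^{−2m·Jtτ}`. [this cell] -/
theorem real_E2_eq : r.real.E2 = Real.exp (-(2 * r.m : ℝ) * ((r.inp.Jt : ℝ) * r.real.τ)) := by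
  rw [inp_Jt, real_τ, JT_mul_TAU]; show Real.exp _ = _; congr 1; push_cast; rw [DEPTH_cast]
/-- `E3 = e^{−(2m−1)·Jtτ}`. [this cell] -/
theorem real_E3_eq : r.real.E3 = Real.exp (-(2 * r.m - 1 : ℝ) * ((r.inp.Jt : ℝ) * r.real.τ)) := by
  rw [inp_Jt, real_τ, JT_mul_TAU]; show Real.exp _ = _; congr 1; push_cast; rw [DEPTH_cast]
/-- `T = ζ⁺(m+1)²·e^{−m·Kwτ}·(Kwτ/m + 1/m²)`. [this cell] -/
theorem real_T_eq : r.real.T = ((zetaHi (r.m + 1) : ℚ) : ℝ) ^ 2 * Real.exp (-(r.m : ℝ) * ((r.inp.Kw : ℝ) * r.real.τ)) *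
    ((r.inp.Kw : ℝ) * r.real.τ / r.m + 1 / (r.m : ℝ) ^ 2) := by
  rw [inp_Kw, real_τ, KW_mul_TAU]
  show ((zetaHi (r.m + 1) ^ 2 * (WL / r.m + 1 / (r.m : ℚ) ^ 2) : ℚ) : ℝ) * Real.exp ((-(r.m : ℚ) * WL : ℚ) : ℝ) = _
  push_cast; rw [WL_cast]; ring
/-- `Gt = ζ⁺(m+1)²·(Kwτ)·e^{−(m+1)·Kwτ}`. [this cell] -/
theorem real_Gt_eq : r.real.Gt = ((zetaHi (r.m + 1) : ℚ) : ℝ) ^ 2 * ((r.inp.Kw : ℝ) * r.real.τ) *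
    Real.exp (-((r.m : ℝ) + 1) * ((r.inp.Kw : ℝ) * r.real.τ)) := by
  rw [inp_Kw, real_τ, KW_mul_TAU]
  show ((zetaHi (r.m + 1) ^ 2 * WL : ℚ) : ℝ) * Real.exp ((-(r.m + 1 : ℚ) * WL : ℚ) : ℝ) = _
  push_cast; rw [WL_cast]
/-- `z = ζ⁺(m+1)`. [this cell] -/
theorem real_z_eq : r.real.z = ((zetaHi (r.m + 1) : ℚ) : ℝ) := rfl

/-! ## The ζ-residues as reals; the decidable sign facts of a passing row (appended) -/

/-- `R` as a real: `ζ⁺(m+1) − Σ_{k ∈ Ico 1 (K+1)} k^{−(m+1)}` (the shape of `T2Matches.R_ge`). [this cell] -/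
theorem real_R_eq : r.real.R = ((zetaHi (r.m + 1) : ℚ) : ℝ) - ∑ k ∈ Finset.Ico 1 (KH + 1), 1 / (k : ℝ) ^ (r.m + 1) := by
  show ((r.resid1 : ℚ) : ℝ) = _
  unfold resid1 KH
  rw [Finset.sum_Ico_eq_sum_range]
  simp only [List.range_succ, List.range_zero, List.map_append, List.map_cons, List.map_nil, List.sum_append, List.sum_cons,
    List.sum_nil, List.nil_append, Finset.sum_range_succ, Finset.sum_range_zero]
  push_cast
  ring

/-- `Rm` as a real: `ζ⁺(m) − Σ_{k ∈ Ico 1 (K+1)} k^{−m}` (the shape of `T2Matches.Rm_ge`). [this cell] -/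
theorem real_Rm_eq : r.real.Rm = ((zetaHi r.m : ℚ) : ℝ) - ∑ k ∈ Finset.Ico 1 (KH + 1), 1 / (k : ℝ) ^ r.m := by
  show ((r.resid0 : ℚ) : ℝ) = _
  unfold resid0 KH
  rw [Finset.sum_Ico_eq_sum_range]
  simp only [List.range_succ, List.range_zero, List.map_append, List.map_cons, List.map_nil, List.sum_append, List.sum_cons,
    List.sum_nil, List.nil_append, Finset.sum_range_succ, Finset.sum_range_zero]
  push_cast
  ring

/-- **The decidable sign facts of a passing row** (`sideQ` inside `check`): residues, `χ_L`, `Σ|c|`, cut values and gain pairs are `≥ 0`.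
[this cell] -/
theorem check_signs (h : r.check = true) :
    0 ≤ r.resid1 ∧ 0 ≤ r.resid0 ∧ 0 ≤ r.chiL ∧ 0 ≤ r.csum ∧ (∀ j < r.ncut, 0 ≤ r.cutVal j ∧ 0 ≤ r.cutDerVal j) ∧
      (∀ j < JG, 0 ≤ r.gainA j ∧ 0 ≤ r.gainB j) := by
  unfold check at h
  simp only [Bool.and_eq_true] at h
  obtain ⟨hQ, -⟩ := h
  unfold sideQ at hQ
  simp only [Bool.and_eq_true, decide_eq_true_eq, List.all_eq_true, List.mem_range] at hQ
  obtain ⟨⟨⟨⟨⟨⟨⟨⟨⟨⟨⟨-, -⟩, -⟩, -⟩, -⟩, -⟩, hR1⟩, hR0⟩, hchi⟩, hcs⟩, hcut⟩, hgain⟩ := hQ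
  exact ⟨hR1, hR0, hchi, hcs, hcut, hgain⟩

/-- `0 ≤ R`, `0 ≤ Rm` as reals for a passing row. [this cell] -/
theorem real_R_nonneg (h : r.check = true) : 0 ≤ r.real.R ∧ 0 ≤ r.real.Rm := by
  obtain ⟨h1, h0, -⟩ := r.check_signs h
  exact ⟨by show (0 : ℝ) ≤ ((r.resid1 : ℚ) : ℝ); exact_mod_cast h1, by show (0 : ℝ) ≤ ((r.resid0 : ℚ) : ℝ); exact_mod_cast h0⟩

end Row2

end Summit.RiemannHypothesis.RiemannHypothesis.Theorems.ThetaTier2
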